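import Literature.MathematicalPhysics.KineticTheory.TaggedSphereFibrePointwise
import Literature.MathematicalPhysics.KineticTheory.TaggedSphereModeRelaxation
import Literature.MathematicalPhysics.KineticTheory.TaggedSphereLinearBoltzmannInputs
import HarnessLib

/-!
# BGSR Theorem 2.3 from Theorem 2.2 alone; the Fourier fibres and the velocity profile of a mode
(Bodineau–Gallagher–Saint-Raymond, Invent. Math. 203 (2016) = arXiv:1305.3397v2, Thm 2.3, §6.1;
bookkeeping for the named fact
`Literature.MathematicalPhysics.KineticTheory.bodineau_gallagher_saintRaymond_diffusive` of
`TaggedSphereDiffusion`)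

With Lemma 6.1 (`bgsr_exists_diffusionCorrector_holds`, `TaggedSphereDiffusionCorrector`) and the
hydrodynamic limit (6.3) (`bgsr_hydrodynamicLimit_holds`, `TaggedSphereModeRelaxation`) discharged
in the tree, the corrected one-time statement of BGSR Theorem 2.3,
`bodineau_gallagher_saintRaymond_diffusive`, depends on exactly one vendored input: Theorem 2.2 in
its uniform form (2.9), `bgsr_linearBoltzmannApprox` (the Lanford-type comparison of BGSR §§3–5).
This is `bodineau_gallagher_saintRaymond_diffusive_of_linearBoltzmannApprox`.

The tree now holds two treatments of the velocity relaxation behind (6.3): the real-variable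
velocity profile `ĝ_n = modeProfile n` of a single mode (`TaggedSphereHydrodynamicModeProfile`,
`TaggedSphereModeEnergy`, `TaggedSphereModeRelaxation`) and the complex Fourier fibres
`ψ_k = seriesFibre` of the solution with a general continuous datum (`TaggedSphereFourierFibre`,
`TaggedSphereFibreEnergy`, `TaggedSphereFibrePointwise`). This file records the dictionary between
them: for the datum `1 + cos(2π n·x)`, `n ≠ 0`,
`ĝ_n(t, v) = 2 ψ_n(t, v)` (`seriesFibre_modeDensity`), `ρ̂⁰(n) = 1/2` (`datumCoeff_modeDensity`),
`λ = 4π² κ_β |n|²` with either wave-vector convention (`heatRate_eq_latticeVec`), whence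
`ĝ_n(ατ, v) - e^{-4π² κ_β |n|² τ} = 2 (ψ_n - ρ̂⁰(n) e^{-λt/α})(ατ, v)` (`modeProfile_sub_eq`); in
particular `TaggedSphereFibrePointwise.norm_fibreDiff_le_of_large` gives a second, independent
proof of the local-in-`v` part of `modeProfile_relaxation`.

## Status of the named fact (review of 2026-08-15, with arXiv:1305.3397v2 pp. 7, 22 open)

`bodineau_gallagher_saintRaymond_diffusive` is BGSR Theorem 2.3 (one-time position marginals) with
the growth restriction its printed proof supports (§6.1.1 after (6.1): "as soon as
`α ≪ (log log N)^{(A-1)/(2A)}`", `A ≥ 2` fixed) — a faithful, top-level rendering of a printed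
theorem, not an intermediate lemma, and the statement the deprecated
`bodineau_gallagher_saintRaymond_brownian` (`ShortRangePotentials`, hilbert6.S22 (d)) points to.
Its printed proof is "Thm 2.3 = (6.1) + (6.3)": the (6.3) half (Lemma 6.1, `κ_β > 0`, the
hydrodynamic limit) and the assembly are PROVED in the tree, so the fact is CLOSED MODULO the one
existing named fact `bgsr_linearBoltzmannApprox` (BGSR Thm 2.2 with its rate (2.9),
`TaggedSphereDiffusion`) by `bodineau_gallagher_saintRaymond_diffusive_of_linearBoltzmannApprox`
below (axioms `propext`, `Classical.choice`, `Quot.sound` only). Thm 2.2 in turn is reduced in the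
tree (`bgsr_linearBoltzmannApprox_of_inputs`, `TaggedSphereLinearBoltzmannInputs`: BGSR §§4–5
assembled) to three inputs on the hard-sphere dynamics stated as hypotheses, not as named facts:
(S) the iterated Duhamel formula up to null sets for the marginals of the transported datum (2.8)
along the regularised hard-sphere flows, (R) the Duhamel terms of the hard-sphere hierarchy model
respect null sets, (Reg) almost every one-particle configuration is regular to all depths. The
composite `bodineau_gallagher_saintRaymond_diffusive_of_inputs` records that BGSR's Brownian-motion
theorem, in the form vendored here, holds conditionally on exactly (S), (R), (Reg); nothing else
of it remains. Its discharge `…_holds` is the one-liner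
`bodineau_gallagher_saintRaymond_diffusive_of_linearBoltzmannApprox bgsr_linearBoltzmannApprox_holds`
as soon as the latter theorem exists. (That composite is placed before this file's local Haar
instances on `ℝ/ℤ`, so that the `volume` in its hypotheses is the tree's standard measure on
`Config s d (UnitAddTorus d)`, syntactically the one of `bgsr_linearBoltzmannApprox_of_inputs`.)

As in `TaggedSphereFourierFibre`, integrals over `T^d` are against the Haar probability measure
(file-local instances as in `Mathlib.Analysis.Fourier.AddCircleMulti`); no exported statement
involves that measure.

## References

* T. Bodineau, I. Gallagher, L. Saint-Raymond, *The Brownian motion as the limit of a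
  deterministic system of hard-spheres*, Invent. Math. 203 (2016) 493–553 = arXiv:1305.3397v2,
  Thm 2.2, (2.9), Thm 2.3, §6.1.1, (6.3).
-/

noncomputable section

open MeasureTheory Metric Set Filter Topology ProbabilityTheory Complex
open scoped InnerProductSpace ENNReal NNReal Real

/-! ## Theorem 2.3 from the three inputs (S), (R), (Reg) on the hard-sphere dynamics -/

namespace Literature.MathematicalPhysics.KineticTheory

section Inputs

open Literature.Analysis.FluidPDE (Config)

variable {d : Type*} [Fintype d]

/-- **BGSR Theorem 2.3 (one-time marginals, corrected growth hypothesis) from the three inputs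
(S), (R), (Reg) on the hard-sphere dynamics.** Composition of the in-tree reduction of Thm 2.2
(2.9) to (S) (iterated Duhamel formula up to null sets for the marginals of the transported BGSR
datum along the regularised flows), (R) (the Duhamel terms of the hard-sphere hierarchy model
respect null sets) and (Reg) (almost every one-particle configuration is regular to all depths)
— `bgsr_linearBoltzmannApprox_of_inputs` (`TaggedSphereLinearBoltzmannInputs`, BGSR §§4–5 with
the proof of Thm 2.2, p. 21) — with Thm 2.3 from Thm 2.2, Lemma 6.1 and (6.3)
(`bodineau_gallagher_saintRaymond_diffusive_of_facts'` of `TaggedSphereDiffusionProofs`, §6.1.1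
(6.1), fed with `bgsr_exists_diffusionCorrector_holds` and `bgsr_hydrodynamicLimit_holds`; the same
composition as `bodineau_gallagher_saintRaymond_diffusive_of_linearBoltzmannApprox` below). The
hypotheses are copied verbatim from `bgsr_linearBoltzmannApprox_of_inputs`; no named fact is
introduced.
[cite: BodineauGallagherSaintRaymondInvent2016, Thm. 2.3 with Thm. 2.2, §6.1.1 (6.1) and Prop. 5.8 (arXiv v2 pp. 7, 21–22)] -/
theorem bodineau_gallagher_saintRaymond_diffusive_of_inputs [DecidableEq d]
    (hS : ∀ (N : ℕ) (ε : ℝ) (hε : 0 < ε) (hε' : ε < 2⁻¹) (β : ℝ) (ρ₀ : UnitAddTorus d → ℝ) (T : ℝ),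
      ∀ s ≤ N + 1, ∀ t ∈ Icc 0 T,
        (hsHierarchyModel (d := d) hε hε' (N + 1)).seriesFamily (N + 1)
            (fun k => bgsrMarginalFamily hε hε' N β ρ₀ k 0) s t =ᵐ[volume]
          bgsrMarginalFamily hε hε' N β ρ₀ s t)
    (hRob : ∀ (N : ℕ) (ε : ℝ) (hε : 0 < ε) (hε' : ε < 2⁻¹),
      (hsHierarchyModel (d := d) hε hε' (N + 1)).RespectsAE (fun _ => volume))
    (hReg : ∀ (ε σ : ℝ), ∀ᵐ z : Config 1 d (UnitAddTorus d), ∀ n, bgsrRegular ε n 1 σ z) :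
    bodineau_gallagher_saintRaymond_diffusive (d := d) :=
  bodineau_gallagher_saintRaymond_diffusive_of_facts' (bgsr_linearBoltzmannApprox_of_inputs hS hRob hReg)
    bgsr_exists_diffusionCorrector_holds bgsr_hydrodynamicLimit_holds

end Inputs

end Literature.MathematicalPhysics.KineticTheory

/-- As in `TaggedSphereFourierFibre`: the measure on `ℝ/ℤ` is the Haar probability measure.
[folklore] -/
local instance diffusiveOfApproxMeasureSpace : MeasureSpace UnitAddCircle := ⟨AddCircle.haarAddCircle⟩

/-- The measure on `ℝ/ℤ` is a Haar measure. [folklore] -/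
local instance diffusiveOfApproxIsAddHaarMeasure : Measure.IsAddHaarMeasure (volume : Measure UnitAddCircle) :=
  inferInstanceAs (Measure.IsAddHaarMeasure AddCircle.haarAddCircle)

/-- The measure on `ℝ/ℤ` is a probability measure. [folklore] -/
local instance diffusiveOfApproxIsProbabilityMeasure : IsProbabilityMeasure (volume : Measure UnitAddCircle) :=
  inferInstanceAs (IsProbabilityMeasure AddCircle.haarAddCircle)

namespace Literature.MathematicalPhysics.KineticTheory

open Literature.Analysis.FunctionSpaces (maxwellianBeta maxwellianBeta_pos)
open TaggedSphereDiffusion (collisionFrequency)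
open UnitAddTorus

variable {d : Type*} [Fintype d] {β α : ℝ}

local notation "𝔼" => EuclideanSpace ℝ d
local notation "𝕋" => UnitAddTorus d

/-- The measure on `(ℝ/ℤ)^d` is a probability measure. [folklore] -/
local instance instIsProbabilityMeasureTorusOfApprox : IsProbabilityMeasure (volume : Measure (UnitAddTorus d)) := by
  rw [volume_pi]; infer_instance

/-! ## The Fourier fibres of the single-mode solution -/

section Mode

open Literature.Analysis.FluidPDE Literature.Analysis.FunctionSpaces

/-- The two wave-vector conventions agree: `kVec n = latticeVec n`. [folklore] -/
theorem kVec_eq_latticeVec [DecidableEq d] (n : d → ℤ) : kVec n = Torus.latticeVec n := by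
  ext i; rw [kVec_apply, Torus.latticeVec_apply]

/-- **Non-constant Fourier monomials have zero Haar mean** (translation by half a period in a
coordinate with `m i ≠ 0` flips the sign). [folklore] -/
theorem integral_mFourier_eq_zero_haar {m : d → ℤ} (hm : m ≠ 0) : ∫ x : 𝕋, mFourier m x = 0 := by
  classical
  obtain ⟨i, hi⟩ : ∃ i, m i ≠ 0 := Function.ne_iff.1 hm
  exact integral_eq_zero_of_add_right_eq_neg (mFourier_add_single_half hi)

omit [Fintype d] in
/-- `n ≠ 0` in `ℤ^d` implies `-n - n ≠ 0`. [folklore] -/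
theorem neg_sub_self_ne_zero {n : d → ℤ} (hn : n ≠ 0) : -n - n ≠ 0 := by
  intro h
  apply hn
  funext i
  have := congrFun h i
  simp only [Pi.sub_apply, Pi.neg_apply, Pi.zero_apply] at this
  change n i = 0
  omega

/-- **The profile is twice the `n`-th fibre of the single-mode solution**: for the datum
`1 + cos(2π n·x)`, `n ≠ 0`, the `n`-th Fourier coefficient of `φ(t, ·, v) = 1 + Re(e_n ĝ_n(t, v))`
is `ĝ_n(t, v)/2`. [folklore] -/
theorem seriesFibre_modeDensity (hβ : 0 < β) (hα : 0 ≤ α) {n : d → ℤ} (hn : n ≠ 0) (t : ℝ) (v : 𝔼) :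
    seriesFibre β α (modeDensity n 1 0) n t v = modeProfile n β α t v / 2 := by
  have ha : (1 : ℝ) ^ 2 + 0 ^ 2 ≤ 1 := by norm_num
  set g := modeProfile n β α t v with hg
  rw [seriesFibre, kineticFibre_eq]
  have hser : ∀ x : 𝕋, ((linearBoltzmannSeries (Torus.geometry d) β α (fun x _ => modeDensity n 1 0 x) t x v : ℝ) : ℂ) =
      1 + (mFourier n x * g + (starRingEnd ℂ) (mFourier n x * g)) / 2 := fun x => by
    rw [linearBoltzmannSeries_modeDensity hβ hα n ha t x v, ← hg]
    push_cast
    rw [Complex.re_eq_add_conj]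
    ring
  simp_rw [hser]
  have hpt : ∀ x : 𝕋, mFourier (-n) x * (1 + (mFourier n x * g + (starRingEnd ℂ) (mFourier n x * g)) / 2) =
      mFourier (-n) x + g / 2 + (starRingEnd ℂ) g / 2 * mFourier (-n - n) x := by
    intro x
    have h1 : mFourier (-n) x * mFourier n x = 1 := by
      rw [← mFourier_add, neg_add_cancel, mFourier_zero]; rfl
    have h2 : mFourier (-n) x * (starRingEnd ℂ) (mFourier n x) = mFourier (-n - n) x := by
      rw [← mFourier_neg, ← mFourier_add, sub_eq_add_neg]
    rw [map_mul]
    calc mFourier (-n) x * (1 + (mFourier n x * g + (starRingEnd ℂ) (mFourier n x) * (starRingEnd ℂ) g) / 2)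
        = mFourier (-n) x + (mFourier (-n) x * mFourier n x) * g / 2 +
            (mFourier (-n) x * (starRingEnd ℂ) (mFourier n x)) * (starRingEnd ℂ) g / 2 := by ring
      _ = _ := by rw [h1, h2]; ring
  simp_rw [hpt]
  have hc : Continuous fun x : 𝕋 => mFourier (-n) x + g / 2 := (mFourier (-n)).continuous.add continuous_const
  have hc2 : Continuous fun x : 𝕋 => (starRingEnd ℂ) g / 2 * mFourier (-n - n) x :=
    continuous_const.mul (mFourier (-n - n)).continuous
  rw [integral_add (integrable_of_continuous_torus hc) (integrable_of_continuous_torus hc2),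
    integral_add (integrable_of_continuous_torus (mFourier (-n)).continuous) (integrable_const _),
    integral_const_mul, integral_mFourier_eq_zero_haar (neg_ne_zero.2 hn),
    integral_mFourier_eq_zero_haar (neg_sub_self_ne_zero hn), integral_const]
  simp

/-- `ρ̂⁰(n) = 1/2` for `ρ⁰ = 1 + cos(2π n·x)`, `n ≠ 0`. [folklore] -/
theorem datumCoeff_modeDensity (hβ : 0 < β) {n : d → ℤ} (hn : n ≠ 0) :
    datumCoeff (modeDensity (d := d) n 1 0) n = 1 / 2 := by
  haveI : Nonempty d ∨ IsEmpty d := (isEmpty_or_nonempty d).symm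
  have h := seriesFibre_modeDensity (α := 0) hβ le_rfl hn 0 (0 : 𝔼)
  rw [seriesFibre, kineticFibre_linearBoltzmannSeries_zero, modeProfile_zero] at h
  exact h

/-- `λ = 4π² κ_β |n|²` with the lattice vector of `FlatTorus`. [folklore] -/
theorem heatRate_eq_latticeVec [DecidableEq d] (β : ℝ) (b : 𝔼 → 𝔼) (n : d → ℤ) :
    heatRate β b n = 4 * π ^ 2 * bgsrDiffusionCoeff β b * ‖Torus.latticeVec n‖ ^ 2 := by
  rw [heatRate, kVec_eq_latticeVec]

/-- The heat factor of the single-mode datum at kinetic time `ατ`: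
`heatFibre(ατ) = ½ e^{-4π² κ_β |n|² τ}`. [folklore] -/
theorem heatFibre_modeDensity [DecidableEq d] (hβ : 0 < β) (hα : α ≠ 0) (b : 𝔼 → 𝔼) {n : d → ℤ} (hn : n ≠ 0) (τ : ℝ) :
    heatFibre β α b (modeDensity n 1 0) n (α * τ) =
      (1 / 2 : ℂ) * (Real.exp (-(4 * π ^ 2 * bgsrDiffusionCoeff β b * ‖Torus.latticeVec n‖ ^ 2 * τ)) : ℂ) := by
  rw [heatFibre, datumCoeff_modeDensity hβ hn, heatRate_eq_latticeVec]
  have harg : -(4 * π ^ 2 * bgsrDiffusionCoeff β b * ‖Torus.latticeVec n‖ ^ 2 / α * (α * τ)) =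
      -(4 * π ^ 2 * bgsrDiffusionCoeff β b * ‖Torus.latticeVec n‖ ^ 2 * τ) := by
    field_simp
  rw [harg]

/-- **The profile minus its limit is twice the fibre difference** at kinetic time `ατ`. [folklore] -/
theorem modeProfile_sub_eq [DecidableEq d] (hβ : 0 < β) (hα : 0 < α) (b : 𝔼 → 𝔼) {n : d → ℤ} (hn : n ≠ 0) (τ : ℝ) (v : 𝔼) :
    modeProfile n β α (α * τ) v -
        (Real.exp (-(4 * π ^ 2 * bgsrDiffusionCoeff β b * ‖Torus.latticeVec n‖ ^ 2 * τ)) : ℂ) =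
      2 * fibreDiff β α b (modeDensity n 1 0) n (α * τ) v := by
  rw [fibreDiff, seriesFibre_modeDensity hβ hα.le hn, heatFibre_modeDensity hβ hα.ne' b hn]
  ring

end Mode

/-! ## Theorem 2.3 from Theorem 2.2 -/

section Discharge

/-- **BGSR Theorem 2.3 (one-time marginals, corrected growth hypothesis) from Theorem 2.2 with
its rate alone.** With Lemma 6.1 (`bgsr_exists_diffusionCorrector_holds`), the positivity of
`κ_β` and the hydrodynamic limit (6.3) (`bgsr_hydrodynamicLimit_holds` of
`TaggedSphereModeRelaxation`) discharged in the tree, the corrected statement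
`bodineau_gallagher_saintRaymond_diffusive` follows from the printed Theorem 2.2 in its uniform
form (2.9) (`bgsr_linearBoltzmannApprox`, the Lanford-type input, BGSR §§3–5) alone.
[cite: BodineauGallagherSaintRaymondInvent2016, Thm. 2.3 and §6.1.1] -/
theorem bodineau_gallagher_saintRaymond_diffusive_of_linearBoltzmannApprox
    (h : bgsr_linearBoltzmannApprox (d := d)) : bodineau_gallagher_saintRaymond_diffusive (d := d) :=
  bodineau_gallagher_saintRaymond_diffusive_of_facts' h bgsr_exists_diffusionCorrector_holds bgsr_hydrodynamicLimit_holds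

end Discharge

end Literature.MathematicalPhysics.KineticTheory
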